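import Literature.AlgebraicGeometry.Resolution.GiraudLogJacobianIdeal
import Literature.AlgebraicGeometry.Resolution.RegularLocalRingsUFD
import Literature.AlgebraicGeometry.Resolution.FlatSlicingCriterion
import Mathlib.RingTheory.Ideal.UFD
import Mathlib.RingTheory.UniqueFactorizationDomain.Multiplicity
import Mathlib.RingTheory.Ideal.Height
import Mathlib.RingTheory.Finiteness.Ideal
import HarnessLib

/-!
# Route `RadicialJung`, crux `CleanModels` (stmt-15917): structure of Giraud's `B(I)`, `D(I)` and the
# finiteness of the colength `c` (Giraud 1983, 2.1 (1)–(3)) — brick B3/FILE 1 of T2-ARCHITECTURE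

Support file (OURS) for PROGRAMME-clean-dim2 / T2 (`HOME/L/res-L0-w81-pv-2/g5/T2-ARCHITECTURE.md`, brick
**B3** «finiteness of the Giraud-singular points», FILE 1 = its commutative-algebra core; seat res-L1-s42-pv-2
g7 on res-plan-2 IDLE POOL DEAL #50 (2)), line `via-clean-models` of the crux `DescentPerfectToAll`
(stmt-0549).  Nothing here is a statement of Hironaka's manuscript.  AI-written; AI review weaker than
expert review.

Giraud (Bull. SMF 111 (1983), 2.1) attaches to a nonzero ideal `I` of the local ring of a regular surface its
bidual `B(I)` ("un idéal inversible"), the ideal `D(I) = I·B(I)⁻¹` and `C(I) = 𝒪_X/D(I)`, "un `𝒪_X`-Module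
cohérent de longueur finie", whose length at `ξ` is `c(I, ξ)`.  The tree renders these Ω-free and over an
arbitrary commutative ring (`principalHullIdeal`, `coprincipalPart`, `giraudColength` of
`GiraudLogJacobianIdeal.lean`, p557089).  This file proves what makes them Giraud's:

* §1 (any commutative ring) `le_principalHullIdeal`, `principalHullIdeal_le`, `mem_coprincipalPart_iff`,
  `le_coprincipalPart`, `coprincipalPart_eq_top_iff`, and **`giraudColength_eq_zero_iff`**: `c = 0` iff
  `D(J(X,f,E(f))) = ⊤` iff `B(J) ≤ J` (the log-Jacobian ideal is its own principal hull, i.e. "invertible").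
* §2 (domain with well-founded divisibility, e.g. noetherian) **`not_coprincipalPart_le_span_singleton_of_prime`**:
  for `I ≠ ⊥` and a prime element `q`, `D(I) ⊄ (q)` — the `q`-adic part of `I` is exhausted by `B(I)`
  (proof: take `b₀ ∈ I` of least `q`-order `n`, `b₀ = qⁿ c`, `q ∤ c`; then `I ≤ (qⁿ)`, so `B(I) ≤ (qⁿ)` and
  `c ∈ D(I)`).
* §3 (unique factorisation domain) **`height_ne_one_of_coprincipalPart_le`**, **`two_le_height_of_coprincipalPart_le`**:
  every prime containing `D(I)` (`I ≠ ⊥`) has height `≥ 2` (height-one primes of a UFD are principal,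
  Mathlib `Ideal.eq_span_singleton_of_height_eq_one`).
* §4 (two-dimensional factorial noetherian local domain — every two-dimensional regular local ring)
  **`exists_pow_maximalIdeal_le_coprincipalPart`**, **`isFiniteLength_quotient_coprincipalPart`** (Giraud's
  "de longueur finie") and **`giraudColength_ne_top`**: `c(X, f, ξ) < ∞` as soon as `J(X, f, E(f)) ≠ 0`;
  regular-local-ring forms `…_of_isRegularLocalRing`.

Consumers: B3 (an `𝔪`-primary `D` has `V(D) = {𝔪}`: off the point the colength vanishes once `D` is read on a
chart), B4/B6 (the measure `(c, δ)` lives in `ℕ`).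

## References
* J. Giraud, Forme normale d'une fonction sur une surface de caractéristique positive, Bull. Soc. Math.
  France 111 (1983) 109–124: 2.1 (1)–(3). [Giraud1983]
* H. Matsumura, Commutative Ring Theory (1986), Thm. 20.3 (regular local ⇒ UFD). [Matsumura1987]
-/

noncomputable section

set_option linter.dupNamespace false -- mandated namespace of this single-conjunct summit

open Literature.AlgebraicGeometry.Resolution IsLocalRing

namespace Summit.ResolutionOfSingularities.ResolutionOfSingularities.Theorems.RadicialJung.CleanModels

universe u

variable {O : Type u} [CommRing O]

/-! ## §1 The principal hull and the coprincipal part over any commutative ring -/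

/-- `I ⊆ B(I)`. -/
theorem le_principalHullIdeal (I : Ideal O) : I ≤ principalHullIdeal I :=
  le_sInf fun _ hP => hP.2

/-- `B(I)` is below every principal ideal containing `I`. -/
theorem principalHullIdeal_le {I P : Ideal O} (hP : P.IsPrincipal) (h : I ≤ P) :
    principalHullIdeal I ≤ P :=
  sInf_le ⟨hP, h⟩

/-- `B(I) ⊆ (g)` whenever `I ⊆ (g)`. -/
theorem principalHullIdeal_le_span_singleton {I : Ideal O} {g : O} (h : I ≤ Ideal.span {g}) :
    principalHullIdeal I ≤ Ideal.span {g} :=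
  principalHullIdeal_le ⟨⟨g, rfl⟩⟩ h

/-- Membership in `D(I) = (I : B(I))`. -/
theorem mem_coprincipalPart_iff {I : Ideal O} {a : O} :
    a ∈ coprincipalPart I ↔ ∀ b ∈ principalHullIdeal I, a * b ∈ I := by
  unfold coprincipalPart
  rw [Submodule.mem_colon]
  simp only [SetLike.mem_coe, smul_eq_mul]

/-- `I ⊆ D(I)`. -/
theorem le_coprincipalPart (I : Ideal O) : I ≤ coprincipalPart I :=
  fun _ ha => mem_coprincipalPart_iff.mpr fun b _ => I.mul_mem_right b ha

/-- `D(I) = ⊤` iff `B(I) ⊆ I` (iff `I` is its own principal hull). -/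
theorem coprincipalPart_eq_top_iff {I : Ideal O} : coprincipalPart I = ⊤ ↔ principalHullIdeal I ≤ I := by
  rw [Ideal.eq_top_iff_one, mem_coprincipalPart_iff]
  simp only [one_mul]
  rfl

/-- **`c = 0` iff `D(J(X, f, E(f))) = ⊤`** (the quotient by `D` is trivial). -/
theorem giraudColength_eq_zero_iff (f : O) :
    giraudColength O f = 0 ↔ coprincipalPart (logDerivJacobianIdeal O f) = ⊤ := by
  unfold giraudColength
  rw [Module.length_eq_zero_iff, Ideal.Quotient.subsingleton_iff]

/-- **`c = 0` iff the log-Jacobian ideal contains its principal hull** (is "invertible" in Giraud's words). -/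
theorem giraudColength_eq_zero_iff_principalHullIdeal_le (f : O) :
    giraudColength O f = 0 ↔ principalHullIdeal (logDerivJacobianIdeal O f) ≤ logDerivJacobianIdeal O f := by
  rw [giraudColength_eq_zero_iff, coprincipalPart_eq_top_iff]

/-! ## §2 No prime element divides the coprincipal part -/

section Domain

variable [IsDomain O] [WfDvdMonoid O]

/-- **`D(I) ⊄ (q)` for every prime element `q` and every `I ≠ ⊥`.**  Take `b₀ ∈ I` whose `q`-order `n` is
least, `b₀ = qⁿ·c` with `q ∤ c`; every element of `I` is divisible by `qⁿ`, so `B(I) ⊆ (qⁿ)` and therefore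
`c·B(I) ⊆ b₀·O ⊆ I`, i.e. `c ∈ D(I)`; `c ∉ (q)`. -/
theorem not_coprincipalPart_le_span_singleton_of_prime {I : Ideal O} (hI : I ≠ ⊥) {q : O} (hq : Prime q) :
    ¬ coprincipalPart I ≤ Ideal.span {q} := by
  classical
  intro hle
  -- the `q`-orders realised in `I`
  have hex : ∃ n : ℕ, ∃ b ∈ I, ∃ c : O, b = q ^ n * c ∧ ¬ q ∣ c := by
    obtain ⟨b, hbI, hb0⟩ := Submodule.exists_mem_ne_zero_of_ne_bot hI
    obtain ⟨n, c, hqc, hb⟩ := WfDvdMonoid.max_power_factor hb0 hq.irreducible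
    exact ⟨n, b, hbI, c, hb, hqc⟩
  let n := Nat.find hex
  obtain ⟨b₀, hb₀I, c, hb₀, hqc⟩ : ∃ b ∈ I, ∃ c : O, b = q ^ n * c ∧ ¬ q ∣ c := Nat.find_spec hex
  -- every element of `I` is divisible by `qⁿ`
  have hdiv : ∀ b ∈ I, q ^ n ∣ b := by
    intro b hbI
    by_cases hb0 : b = 0
    · rw [hb0]; exact dvd_zero _
    · obtain ⟨k, a, hqa, hb⟩ := WfDvdMonoid.max_power_factor hb0 hq.irreducible
      have hnk : n ≤ k := Nat.find_min' hex ⟨b, hbI, a, hb, hqa⟩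
      rw [hb]
      exact dvd_mul_of_dvd_left (pow_dvd_pow q hnk) a
  have hIle : I ≤ Ideal.span {q ^ n} := fun b hb => Ideal.mem_span_singleton.mpr (hdiv b hb)
  have hBle : principalHullIdeal I ≤ Ideal.span {q ^ n} := principalHullIdeal_le_span_singleton hIle
  -- `c ∈ D(I)`
  have hc : c ∈ coprincipalPart I := by
    rw [mem_coprincipalPart_iff]
    intro h hh
    obtain ⟨h', hh'⟩ := Ideal.mem_span_singleton'.mp (hBle hh)
    have : c * h = h' * b₀ := by rw [← hh', hb₀]; ring
    rw [this]
    exact I.mul_mem_left h' hb₀I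
  -- contradiction
  exact hqc (Ideal.mem_span_singleton.mp (hle hc))

end Domain

/-! ## §3 In a factorial domain every prime over `D(I)` has height at least two -/

section UFD

variable [IsDomain O] [UniqueFactorizationMonoid O]

/-- A prime ideal containing `D(I)` (`I ≠ ⊥`) is not of height one (height-one primes of a factorial domain
are principal, generated by a prime element). -/
theorem height_ne_one_of_coprincipalPart_le {I : Ideal O} (hI : I ≠ ⊥) {P : Ideal O} [P.IsPrime]
    (h : coprincipalPart I ≤ P) : P.height ≠ 1 := by
  intro h1
  obtain ⟨q, hqP, hq⟩ := Ideal.IsPrime.exists_mem_prime_of_ne_bot ‹_› (Ideal.ne_bot_of_height_eq_one h1)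
  have hP : P = Ideal.span {q} := Ideal.eq_span_singleton_of_height_eq_one h1 hqP hq
  exact not_coprincipalPart_le_span_singleton_of_prime hI hq (hP ▸ h)

omit [IsDomain O] [UniqueFactorizationMonoid O] in
/-- A prime ideal containing `D(I)` (`I ≠ ⊥`) is nonzero. -/
theorem ne_bot_of_coprincipalPart_le {I : Ideal O} (hI : I ≠ ⊥) {P : Ideal O} (h : coprincipalPart I ≤ P) :
    P ≠ ⊥ :=
  fun hP => hI (le_bot_iff.mp (((le_coprincipalPart I).trans h).trans hP.le))

/-- **Every prime containing `D(I)` has height `≥ 2`** (`I ≠ ⊥`, factorial domain). -/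
theorem two_le_height_of_coprincipalPart_le {I : Ideal O} (hI : I ≠ ⊥) {P : Ideal O} [P.IsPrime]
    (h : coprincipalPart I ≤ P) : 2 ≤ P.height := by
  have h0 : P.height ≠ 0 := fun h0 =>
    ne_bot_of_coprincipalPart_le hI h (Ideal.height_eq_zero_iff_eq_bot.mp h0)
  have h1 : P.height ≠ 1 := height_ne_one_of_coprincipalPart_le hI h
  generalize P.height = x at h0 h1
  induction x using ENat.recTopCoe with
  | top => exact le_top
  | coe n =>
    have h0' : n ≠ 0 := fun h => h0 (by simp [h])
    have h1' : n ≠ 1 := fun h => h1 (by simp [h])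
    exact_mod_cast (show 2 ≤ n by omega)

end UFD

/-! ## §4 Two-dimensional factorial local domains: finite colength (Giraud 2.1 (2)) -/

section LocalDimTwo

variable [IsDomain O] [UniqueFactorizationMonoid O] [IsNoetherianRing O] [IsLocalRing O]

/-- In a two-dimensional factorial noetherian local domain, **every prime over `D(I)` is the maximal ideal**
(`I ≠ ⊥`). -/
theorem eq_maximalIdeal_of_coprincipalPart_le (hdim : ringKrullDim O = 2) {I : Ideal O} (hI : I ≠ ⊥)
    {P : Ideal O} [P.IsPrime] (h : coprincipalPart I ≤ P) : P = maximalIdeal O := by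
  have h2 : 2 ≤ P.height := two_le_height_of_coprincipalPart_le hI h
  have hle : P.height ≤ 2 := by
    have h' := Ideal.height_le_ringKrullDim_of_isPrime (I := P)
    rw [hdim] at h'
    exact WithBot.coe_le_coe.mp h'
  have hP2 : P.height = 2 := le_antisymm hle h2
  have heq : (P.height : WithBot ℕ∞) = ringKrullDim O := by rw [hdim, hP2]; rfl
  exact Ideal.height_eq_ringKrullDim_iff.mp heq

/-- **Some power of the maximal ideal lies in `D(I)`** (`I ≠ ⊥`): `D(I)` is `⊤` or `𝔪`-primary. -/
theorem exists_pow_maximalIdeal_le_coprincipalPart (hdim : ringKrullDim O = 2) {I : Ideal O} (hI : I ≠ ⊥) :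
    ∃ n : ℕ, maximalIdeal O ^ n ≤ coprincipalPart I := by
  have hrad : maximalIdeal O ≤ (coprincipalPart I).radical := by
    rw [Ideal.radical_eq_sInf]
    refine le_sInf fun J hJ => ?_
    haveI : J.IsPrime := hJ.2
    exact (eq_maximalIdeal_of_coprincipalPart_le hdim hI hJ.1).symm.le
  exact Ideal.exists_pow_le_of_le_radical_of_fg hrad (IsNoetherian.noetherian _)

/-- **Giraud 2.1 (2): `𝒪/D(I)` has finite length** (`I ≠ ⊥`, two-dimensional factorial noetherian local domain). -/
theorem isFiniteLength_quotient_coprincipalPart (hdim : ringKrullDim O = 2) {I : Ideal O} (hI : I ≠ ⊥) :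
    IsFiniteLength O (O ⧸ coprincipalPart I) := by
  obtain ⟨n, hn⟩ := exists_pow_maximalIdeal_le_coprincipalPart hdim hI
  exact Matsumura1987.isFiniteLength_quotient_of_pow_le hn

/-- **Giraud 2.1 (3) / 2.2 (2): the colength `c(X, f, ξ)` is finite** as soon as the log-Jacobian ideal is
nonzero (two-dimensional factorial noetherian local domain). -/
theorem giraudColength_ne_top (hdim : ringKrullDim O = 2) {f : O} (hJ : logDerivJacobianIdeal O f ≠ ⊥) :
    giraudColength O f ≠ ⊤ := by
  unfold giraudColength
  rw [Module.length_ne_top_iff]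
  exact isFiniteLength_quotient_coprincipalPart hdim hJ

end LocalDimTwo

/-! ### Regular local rings of dimension two -/

section Regular

variable [IsRegularLocalRing O]

/-- **In a two-dimensional regular local ring `𝒪/D(I)` has finite length** (`I ≠ ⊥`; Auslander–Buchsbaum
`IsRegularLocalRing.uniqueFactorizationMonoid` + §4). -/
theorem isFiniteLength_quotient_coprincipalPart_of_isRegularLocalRing (hdim : ringKrullDim O = 2)
    {I : Ideal O} (hI : I ≠ ⊥) : IsFiniteLength O (O ⧸ coprincipalPart I) := by
  letI := isDomain_of_isRegularLocalRing O
  haveI : UniqueFactorizationMonoid O := IsRegularLocalRing.uniqueFactorizationMonoid O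
  exact isFiniteLength_quotient_coprincipalPart hdim hI

/-- **Giraud's `c(X, f, ξ) < ∞` on a regular surface**: in a two-dimensional regular local ring the colength
is finite as soon as `J(X, f, E(f)) ≠ 0`. -/
theorem giraudColength_ne_top_of_isRegularLocalRing (hdim : ringKrullDim O = 2) {f : O}
    (hJ : logDerivJacobianIdeal O f ≠ ⊥) : giraudColength O f ≠ ⊤ := by
  letI := isDomain_of_isRegularLocalRing O
  haveI : UniqueFactorizationMonoid O := IsRegularLocalRing.uniqueFactorizationMonoid O
  exact giraudColength_ne_top hdim hJ

/-- In a two-dimensional regular local ring every prime over `D(I)` (`I ≠ ⊥`) is the maximal ideal: **the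
support of `𝒪/D(I)` is the closed point** (the local form of B3's «`V(D) ⊆ {x}`»). -/
theorem eq_maximalIdeal_of_coprincipalPart_le_of_isRegularLocalRing (hdim : ringKrullDim O = 2)
    {I : Ideal O} (hI : I ≠ ⊥) {P : Ideal O} [P.IsPrime] (h : coprincipalPart I ≤ P) :
    P = maximalIdeal O := by
  letI := isDomain_of_isRegularLocalRing O
  haveI : UniqueFactorizationMonoid O := IsRegularLocalRing.uniqueFactorizationMonoid O
  exact eq_maximalIdeal_of_coprincipalPart_le hdim hI h

end Regular

end Summit.ResolutionOfSingularities.ResolutionOfSingularities.Theorems.RadicialJung.CleanModels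

end
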